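import Summits.NavierStokesRegularity.NavierStokesRegularity.Theorems.ScenarioCensusRowF1StarTop
import HarnessLib

/-!
# LINE 38 «star-top» port, part 2/2: §5 the calm-star row PROVED (`rowF1st_holds`, `rowF1se_holds`), the threshold `starLevel`, the STAR floor, residual `StarCollapse` ≡ `Row_F1`,
# the named members (LINE 37's needle `k = 1` BY NAME: `rowF1nd_of_rowF1st`; ODD / counterflow `Row_F1od`, `rowF1od_holds`, the odd floor), the mass-zero boundary; §7 summary;
# census KEYS `Row_F1st` / `Row_F1se` / `Row_F1od` + `_excluded`, floor STF, edges

Re-homed for the scenario census (typer seat ns-census-typer-1 g10; the cells F1st / F1se / F1od and the floor STF are MEMBERS OF RECORD «DECIDED IN KERNEL IN FILES» of row F1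
(item 81: critic idea-crit-3 PASS no price tier B−, KEY-NS #215; ref PRE-CHECK ✓ §19.2; lead label); this port makes them TREE-decided): VERBATIM PORT of ns-idea-3 LINE 38 «star-top»,
`pub/ideators/ns-idea-3/lines/star-top/line-star-top.lean` sha16 f51dcbbb884150b4 (850 l., lean check rc 0, 0 sorry), split for the 400-line rule into
`ScenarioCensusRowF1StarTop` (§1–§4) → `…StarTopRows` (§5–§7 + census KEYS).  Lean text VERBATIM in namespace `…Theorems.ScenarioCensus.StarTop` (the line's
`…Cruxes.ScenarioCensusRowF1.StarTopLine` re-homed); port edits: the frame restated VERBATIM by the line from LINES 34–37 (`topSet`, `HasTypeIConstant`, `snapLevel`, `exists_fast_at`,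
`limitClass_compact`, `exists_level_of_limitKill`, `exists_snapshotZoom_package`, `zoom_units`, `CalmNeedlesAt`, `Row_F1nd`) is taken BY NAME from the landed two-time-top /
one-level-top / snapshot-top / needle-top ports; the second proof term `rowF1nd_holds` is not re-declared (route `rowF1nd_of_rowF1st rowF1st_holds`); `@[conjecture]` on the residual
`StarCollapse` (≡ `ScenarioCensus.Row_F1`, OPEN); one-line docstrings added where missing (gate lint).  Statements untouched.

No census VALUE is moved here (row F1 stays OPEN-WITH-LINE; the members become TREE-decided by name); NS regularity is NOT proved; `Row_F1` is untouched (zero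
movement, `starCollapse_iff_rowF1`); no summit statement is proved by this file. Lemmas that restate already-landed tree declarations are taken BY NAME (gate lint `dedup.landed`): `topSet` = `TwoTimeTop.topSet`, `HasTypeIConstant` = `OneLevelTop.HasTypeIConstant`, `snapLevel` = `SnapshotTop.snapLevel`, `exists_fast_at` = `SnapshotTop.exists_fast_at`, `sqrt_mul_sq_mul` = `SnapshotTop.sqrt_mul_sq_mul`, `limitClass_compact` = `NeedleTop.limitClass_compact`, `exists_level_of_limitKill` = `NeedleTop.exists_level_of_limitKill`, `exists_snapshotZoom_package` = `NeedleTop.exists_snapshotZoom_package`, `zoom_units` = `NeedleTop.zoom_units`, `CalmNeedlesAt` = `NeedleTop.CalmNeedlesAt`, `Row_F1nd` = `NeedleTop.Row_F1nd`.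
-/

-- the summit and its single problem share the name `NavierStokesRegularity` (D-0017 nested layout)
set_option linter.dupNamespace false

noncomputable section

open MeasureTheory Set Function Filter TopologicalSpace Metric
open scoped Topology NNReal ENNReal InnerProductSpace

namespace Summit.NavierStokesRegularity.NavierStokesRegularity.Theorems.ScenarioCensus.StarTop

open Literature.Analysis Literature.Analysis.FluidPDE
open Summit.NavierStokesRegularity.NavierStokesRegularity.Theorems
open Summit.NavierStokesRegularity.NavierStokesRegularity.Theses

/-! ## §5 The CALM-STAR ROW, proved; the definite threshold `starLevel M A a c`; the STAR floor; residual ≡ row F1; the named cells (needle `k = 1`, ODD / counterflow `k = 2`); the mass-zero boundary -/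

-- `zoom_units`: the line restates the tree's `NeedleTop.zoom_units`; taken BY NAME (gate lint dedup.landed).

/-- **ROW F1st holds** (snapshot package of §3 + star level of §4). -/
theorem rowF1st_holds : Row_F1st := by
  intro M A a k c ha hc
  obtain ⟨Λ₁, hΛ₁, hlev⟩ := exists_starLevel M A a c ha hc SnapshotTop.snapLevel_pos
  refine ⟨Λ₁, hΛ₁, ?_⟩
  intro ν T hν hT u p hsol hLH hdec hM hfreq
  by_contra hmax
  obtain ⟨σ, x, W, hσpos, -, hW, hQ, hxfast, -, -, hlu, hnorm⟩ :=
    NeedleTop.exists_snapshotZoom_package hν hT hsol hLH hdec hM hmax hfreq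
  apply hlev W hW hnorm
  -- the snapshot hypothesis at the centre times, read in the zoom: calm stars `(e_j, r₀_j)`,
  -- `‖∑ i, c i • Z_j((r₀_j + ρ) e_j i)‖ ≤ Λ₁` (the zoom factor `σ j * 1` is pulled through the weighted sum)
  have hpk : ∀ j, ∃ e : Fin k → E3, (∀ i, ‖e i‖ = 1) ∧ ∃ r₀ ∈ Icc (0 : ℝ) A, ∀ ρ ∈ Icc (0 : ℝ) a,
      ‖∑ i, c i • (σ j * 1) • u (T + σ j ^ 2 * ν * (-1)) (x j + (σ j * ν) • ((r₀ + ρ) • e i))‖ ≤ Λ₁ := by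
    intro j
    obtain ⟨hunit, hsq⟩ := NeedleTop.zoom_units (T := T) hν hσpos j
    obtain ⟨e, he, r₀, hr₀, hcalm⟩ := hQ j (x j) (hxfast j)
    refine ⟨e, he, r₀, hr₀, fun ρ hρ => ?_⟩
    have hr : r₀ + ρ ∈ Icc r₀ (r₀ + a) := ⟨by linarith [hρ.1], by linarith [hρ.2]⟩
    have h1 := hcalm (r₀ + ρ) hr
    rw [hunit, hsq] at h1
    have e1 : ∀ i, x j + (σ j * ν) • ((r₀ + ρ) • e i) = x j + ((r₀ + ρ) * (σ j * ν)) • e i := by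
      intro i; rw [smul_smul, mul_comm]
    have e2 : (∑ i, c i • (σ j * 1) • u (T + σ j ^ 2 * ν * (-1)) (x j + (σ j * ν) • ((r₀ + ρ) • e i))) =
        (σ j * 1) • ∑ i, c i • u (T + σ j ^ 2 * ν * (-1)) (x j + ((r₀ + ρ) * (σ j * ν)) • e i) := by
      rw [Finset.smul_sum]
      refine Finset.sum_congr rfl fun i _ => ?_
      rw [e1 i, smul_comm]
    rw [e2, norm_smul, Real.norm_eq_abs, abs_of_pos (mul_pos (hσpos j) one_pos), mul_one]
    set q : ℝ := ‖∑ i, c i • u (T + σ j ^ 2 * ν * (-1)) (x j + ((r₀ + ρ) * (σ j * ν)) • e i)‖ with hq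
    have h2 : σ j * q * Real.sqrt ν ≤ Λ₁ * Real.sqrt ν := by
      linarith [h1, mul_comm (Real.sqrt ν) q, mul_assoc (σ j) (Real.sqrt ν) q]
    exact le_of_mul_le_mul_right h2 (Real.sqrt_pos.2 hν)
  choose e he r₀ hr₀ hcalm using hpk
  have hcont : Continuous (W (-1)) := hW.continuous_slice (by norm_num)
  have hcalm' : ∀ j, ∀ ρ ∈ Icc (0 : ℝ) a,
      ‖∑ i, c i • (fun y : E3 => (σ j * 1) • u (T + σ j ^ 2 * ν * (-1)) (x j + (σ j * ν) • y)) ((r₀ j + ρ) • e j i)‖ ≤ Λ₁ :=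
    fun j ρ hρ => hcalm j ρ hρ
  obtain ⟨e₀, he₀, ρ₀, hρ₀, hlim⟩ :=
    star_limit c (hlu (-1) (by norm_num)) hcont he hr₀ (tendsto_const_nhds (x := Λ₁)) hcalm'
  exact ⟨e₀, he₀, ρ₀, hρ₀, hlim⟩

/-- **Row F1se holds.** -/
theorem rowF1se_holds : Row_F1se := rowF1se_of_rowF1st rowF1st_holds

/-- **The definite calm-star threshold `ε(M, A, a, c)`** (a choice; `1` when `a ≤ 0` or the mass vanishes, where nothing is
claimed).  Ineffective (compactness). -/
def starLevel (M A a : ℝ) {k : ℕ} (c : Fin k → ℝ) : ℝ :=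
  if h : 0 < a ∧ ∑ i, c i ≠ 0 then Classical.choose (rowF1st_holds M A a k c h.1 h.2) else 1

/-- The definite calm-star threshold is positive. -/
theorem starLevel_pos (M A a : ℝ) {k : ℕ} (c : Fin k → ℝ) : 0 < starLevel M A a c := by
  unfold starLevel
  split_ifs with h
  · exact (Classical.choose_spec (rowF1st_holds M A a k c h.1 h.2)).1
  · exact one_pos

/-- **Row F1st at the named threshold.** -/
theorem starLevel_spec {a : ℝ} (M A : ℝ) {k : ℕ} {c : Fin k → ℝ} (ha : 0 < a) (hc : ∑ i, c i ≠ 0) :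
    ∀ (ν T : ℝ), 0 < ν → 0 < T → ∀ (u : ℝ → E3 → E3) (p : ℝ → E3 → ℝ),
    IsClassicalNSSolutionOn (Ico 0 T) ν 0 u p → IsLerayHopfOn T ν 0 (u 0) u →
    HasRapidSpatialDecay (u 0) → OneLevelTop.HasTypeIConstant ν T M u →
    (∃ᶠ t in 𝓝[<] T, CalmStarAt ν T u SnapshotTop.snapLevel A a c (starLevel M A a c) t) →
    HasSmoothExtensionPast ν 0 u T := by
  have e : starLevel M A a c = Classical.choose (rowF1st_holds M A a k c ha hc) := by
    unfold starLevel; rw [dif_pos ⟨ha, hc⟩]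
  rw [e]
  exact (Classical.choose_spec (rowF1st_holds M A a k c ha hc)).2

/-- Reading of the negated snapshot condition: some `Λ`-fast point `x` such that EVERY `c`-weighted star out of `x` (every choice of
unit directions, every start `r₀ ∈ [0, A]`) carries, within length `a`, a radius where the weighted sum has dimensionless size `> ε`. -/
theorem not_calmStarAt_iff {ν T : ℝ} {u : ℝ → E3 → E3} {Λ A a : ℝ} {k : ℕ} {c : Fin k → ℝ} {ε t : ℝ} :
    ¬ CalmStarAt ν T u Λ A a c ε t ↔ ∃ x ∈ TwoTimeTop.topSet ν T u Λ t, ∀ e : Fin k → E3, (∀ i, ‖e i‖ = 1) → ∀ r₀ ∈ Icc (0 : ℝ) A,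
      ∃ r ∈ Icc r₀ (r₀ + a),
        ε * Real.sqrt ν < Real.sqrt (T - t) * ‖∑ i, c i • u t (x + (r * Real.sqrt (ν * (T - t))) • e i)‖ := by
  unfold CalmStarAt
  push Not
  rfl

/-- **THE STAR FLOOR** (maximal frame, EVERY LATE TIME; PROVED, `starFloor_holds`): at a maximal Type-I Clay solution with
constant `M`, for every reach `A`, length `a > 0` and weights `c` of nonzero mass, for ALL `t` close to `T` the `c_S`-top at `t` does
NOT carry `ε(M,A,a,c)`-calm `c`-stars — in particular (ODD cell) the flow is NOT nearly odd about every fast point along some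
direction at parabolic distances `[r₀, r₀ + a]`, `r₀ ≤ A`: a Type-I top never sits, at any late instant, at the centre of an
`ε`-exact COUNTERFLOW / converging-jet configuration. -/
def StarFloor : Prop :=
  ∀ (ν T : ℝ), 0 < ν → 0 < T → ∀ (u : ℝ → E3 → E3) (p : ℝ → E3 → ℝ),
    IsMaximalSmoothSolution ν 0 u p T → IsLerayHopfOn T ν 0 (u 0) u → HasRapidSpatialDecay (u 0) →
    ∀ (M A a : ℝ) (k : ℕ) (c : Fin k → ℝ), OneLevelTop.HasTypeIConstant ν T M u → 0 < a → ∑ i, c i ≠ 0 →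
      ∀ᶠ t in 𝓝[<] T, ¬ CalmStarAt ν T u SnapshotTop.snapLevel A a c (starLevel M A a c) t

/-- **The STAR floor holds.** -/
theorem starFloor_holds : StarFloor := by
  intro ν T hν hT u p hmax hLH hdec M A a k c hM ha hc
  by_contra hno
  rw [Filter.not_eventually] at hno
  apply hmax.2 (starLevel_spec M A ha hc ν T hν hT u p hmax.1 hLH hdec hM ?_)
  exact hno.mono fun t ht => not_not.1 ht

/-- The floor read pointwise. -/
theorem starFloor_read {ν T : ℝ} (hν : 0 < ν) (hT : 0 < T) {u : ℝ → E3 → E3} {p : ℝ → E3 → ℝ}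
    (hmax : IsMaximalSmoothSolution ν 0 u p T) (hLH : IsLerayHopfOn T ν 0 (u 0) u) (hdec : HasRapidSpatialDecay (u 0))
    {M A a : ℝ} {k : ℕ} {c : Fin k → ℝ} (hM : OneLevelTop.HasTypeIConstant ν T M u) (ha : 0 < a) (hc : ∑ i, c i ≠ 0) :
    ∀ᶠ t in 𝓝[<] T, ∃ x ∈ TwoTimeTop.topSet ν T u SnapshotTop.snapLevel t, ∀ e : Fin k → E3, (∀ i, ‖e i‖ = 1) → ∀ r₀ ∈ Icc (0 : ℝ) A,
      ∃ r ∈ Icc r₀ (r₀ + a),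
        starLevel M A a c * Real.sqrt ν <
          Real.sqrt (T - t) * ‖∑ i, c i • u t (x + (r * Real.sqrt (ν * (T - t))) • e i)‖ :=
  (starFloor_holds ν T hν hT u p hmax hLH hdec M A a k c hM ha hc).mono fun _ ht => not_calmStarAt_iff.1 ht

/-- **Residual «STAR COLLAPSE»** (maximal frame): every maximal Type-I Clay blow-up with constant `M` admits, for SOME reach `A`,
length `a > 0` and weights `c` of nonzero mass, calm-star snapshots at the threshold `ε(M, A, a, c)` along some `t_k ↑ T`.
DECLARED ≡ row F1 (`starCollapse_iff_rowF1`); no movement on `Row_F1` is claimed. -/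
@[conjecture] def StarCollapse : Prop :=
  ∀ (ν T : ℝ), 0 < ν → 0 < T → ∀ (u : ℝ → E3 → E3) (p : ℝ → E3 → ℝ),
    IsMaximalSmoothSolution ν 0 u p T → IsLerayHopfOn T ν 0 (u 0) u → HasRapidSpatialDecay (u 0) →
    ∀ M : ℝ, OneLevelTop.HasTypeIConstant ν T M u →
      ∃ (A a : ℝ) (k : ℕ) (c : Fin k → ℝ), 0 < a ∧ ∑ i, c i ≠ 0 ∧
        ∃ᶠ t in 𝓝[<] T, CalmStarAt ν T u SnapshotTop.snapLevel A a c (starLevel M A a c) t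

/-- **The split**: star row (proved) + residual ⇒ row F1 (target BY NAME). -/
theorem rowF1_of_starCollapse (hR : StarCollapse) : ScenarioCensus.Row_F1 := by
  unfold ScenarioCensus.Row_F1
  intro ν T hν hT u p hsol hLH hdec hTI
  by_contra hext
  obtain ⟨M, hM⟩ := OneLevelTop.exists_hasTypeIConstant hν hTI
  obtain ⟨A, a, k, c, ha, hc, hfreq⟩ := hR ν T hν hT u p ⟨hsol, hext⟩ hLH hdec M hM
  exact hext (starLevel_spec M A ha hc ν T hν hT u p hsol hLH hdec hM hfreq)

/-- The residual is a consequence of row F1 (vacuously). -/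
theorem starCollapse_of_rowF1 (h : ScenarioCensus.Row_F1) : StarCollapse :=
  fun ν T hν hT u p hmax hLH hdec _ hM =>
    (hmax.2 (h ν T hν hT u p hmax.1 hLH hdec hM.isTypeIBlowup)).elim

/-- The residual `StarCollapse` is EXACTLY `Row_F1`. -/
theorem starCollapse_iff_rowF1 : StarCollapse ↔ ScenarioCensus.Row_F1 :=
  ⟨rowF1_of_starCollapse, starCollapse_of_rowF1⟩

/-! ### The named cells, in kernel: LINE 37's CALM NEEDLE (`k = 1`, `c = 1`) and the ODD / COUNTERFLOW cell (`k = 2`,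
`c = (1, 1)`, `e₁ = −e₀`); the MASS-ZERO boundary

ORDER: `NeedleTop.CalmNeedlesAt ⟹ CalmStarAt (k = 1)` and `OddCalmAt ⟹ CalmStarAt (k = 2, c = 1)` pointwise in `t`, so
`Row_F1st ⟹ NeedleTop.Row_F1nd` (LINE 37's row of record, RE-PROVED here as the one-ray member) and `Row_F1st ⟹ Row_F1od`.  No converse is
claimed: for `k ≥ 2` a calm star asks NO point to be calm.  MASS ZERO: a uniform stream `v` (fast everywhere at a suitable level)
carries calm BALANCED stars of every shape at threshold `0` (`calmStarAt_const_of_sum_eq_zero`), and (KΣ) then concludes `0 = 0`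
(`star_kill_vacuous_of_sum_eq_zero`): balanced read-outs are blind to the constant mode; no row is claimed for them. -/

-- `CalmNeedlesAt`: the line restates the tree's `NeedleTop.CalmNeedlesAt`; taken BY NAME (gate lint dedup.landed).

-- `Row_F1nd`: the line restates the tree's `NeedleTop.Row_F1nd`; taken BY NAME (gate lint dedup.landed).

/-- **A calm needle is a calm one-ray star** (`k = 1`, weight `1`). -/
theorem calmStarAt_of_calmNeedlesAt {ν T : ℝ} {u : ℝ → E3 → E3} {Λ A a ε t : ℝ}
    (h : NeedleTop.CalmNeedlesAt ν T u Λ A a ε t) : CalmStarAt ν T u Λ A a (fun _ : Fin 1 => (1 : ℝ)) ε t := by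
  intro x hx
  obtain ⟨e, he, r₀, hr₀, hcalm⟩ := h x hx
  refine ⟨fun _ => e, fun _ => he, r₀, hr₀, fun r hr => ?_⟩
  simpa using hcalm r hr

/-- **ORDER: the star row contains LINE 37's needle row** (the one-ray member). -/
theorem rowF1nd_of_rowF1st (h : Row_F1st) : NeedleTop.Row_F1nd := by
  intro M A a ha
  obtain ⟨ε, hε, hrow⟩ := h M A a 1 (fun _ => (1 : ℝ)) ha (by simp)
  exact ⟨ε, hε, fun ν T hν hT u p hsol hLH hdec hM hfr =>
    hrow ν T hν hT u p hsol hLH hdec hM (hfr.mono fun t ht => calmStarAt_of_calmNeedlesAt ht)⟩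

-- `rowF1nd_holds`: a second proof term for LINE 37's row F1nd (statement identical to the landed `NeedleTop.rowF1nd_holds`); not re-declared — the order route is `rowF1nd_of_rowF1st rowF1st_holds`.

/-- **Nearly ODD about the fast point at ONE instant `t`** (the COUNTERFLOW cell): every `Λ`-fast point `x` carries a unit
direction `e` and a start `r₀ ∈ [0, A]` such that for `r ∈ [r₀, r₀ + a]` the velocities at the ANTIPODAL points `x ± r ℓ e`
nearly CANCEL: `√(T − t) ‖u(t, x + rℓe) + u(t, x − rℓe)‖ ≤ ε √ν`.  Both velocities may be of full Type-I size (converging or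
diverging jets flanking the fast point); with both small it degenerates to two calm needles. -/
def OddCalmAt (ν T : ℝ) (u : ℝ → E3 → E3) (Λ A a ε t : ℝ) : Prop :=
  ∀ x ∈ TwoTimeTop.topSet ν T u Λ t, ∃ e : E3, ‖e‖ = 1 ∧ ∃ r₀ ∈ Icc (0 : ℝ) A,
    ∀ r ∈ Icc r₀ (r₀ + a),
      Real.sqrt (T - t) * ‖u t (x + (r * Real.sqrt (ν * (T - t))) • e) +
        u t (x - (r * Real.sqrt (ν * (T - t))) • e)‖ ≤ ε * Real.sqrt ν

/-- **ROW F1od «ODD-CALM (COUNTERFLOW) SNAPSHOTS»** (Type I · no symmetry · Clay class; PROVED, `rowF1od_holds`): for every `M`,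
`A`, `a > 0` there is `ε(M, A, a) > 0` such that Type-I(`M`) + frequently-as-`t ↑ T` nearly-odd antipodal pairs of length `aℓ`
starting within `Aℓ` at every `c_S`-fast point ⇒ smooth extension.  No point is asked to be calm. -/
def Row_F1od : Prop :=
  ∀ (M A a : ℝ), 0 < a → ∃ ε : ℝ, 0 < ε ∧
    ∀ (ν T : ℝ), 0 < ν → 0 < T → ∀ (u : ℝ → E3 → E3) (p : ℝ → E3 → ℝ),
    IsClassicalNSSolutionOn (Ico 0 T) ν 0 u p → IsLerayHopfOn T ν 0 (u 0) u →
    HasRapidSpatialDecay (u 0) → OneLevelTop.HasTypeIConstant ν T M u →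
    (∃ᶠ t in 𝓝[<] T, OddCalmAt ν T u SnapshotTop.snapLevel A a ε t) →
    HasSmoothExtensionPast ν 0 u T

/-- **A nearly odd antipodal pair is a calm two-ray star** (`k = 2`, weights `(1, 1)`, directions `(e, −e)`). -/
theorem calmStarAt_of_oddCalmAt {ν T : ℝ} {u : ℝ → E3 → E3} {Λ A a ε t : ℝ}
    (h : OddCalmAt ν T u Λ A a ε t) : CalmStarAt ν T u Λ A a (fun _ : Fin 2 => (1 : ℝ)) ε t := by
  intro x hx
  obtain ⟨e, he, r₀, hr₀, hcalm⟩ := h x hx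
  refine ⟨![e, -e], ?_, r₀, hr₀, fun r hr => ?_⟩
  · intro i
    fin_cases i <;> simp [he]
  · have h1 := hcalm r hr
    have e1 : (∑ i : Fin 2, (1 : ℝ) • u t (x + (r * Real.sqrt (ν * (T - t))) • (![e, -e] : Fin 2 → E3) i)) =
        u t (x + (r * Real.sqrt (ν * (T - t))) • e) + u t (x - (r * Real.sqrt (ν * (T - t))) • e) := by
      simp [Fin.sum_univ_two, smul_neg, sub_eq_add_neg]
    rw [e1]
    exact h1

/-- **ORDER: the star row contains the odd / counterflow row.** -/
theorem rowF1od_of_rowF1st (h : Row_F1st) : Row_F1od := by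
  intro M A a ha
  obtain ⟨ε, hε, hrow⟩ := h M A a 2 (fun _ => (1 : ℝ)) ha (by simp)
  exact ⟨ε, hε, fun ν T hν hT u p hsol hLH hdec hM hfr =>
    hrow ν T hν hT u p hsol hLH hdec hM (hfr.mono fun t ht => calmStarAt_of_oddCalmAt ht)⟩

/-- **Row F1od holds.** -/
theorem rowF1od_holds : Row_F1od := rowF1od_of_rowF1st rowF1st_holds

/-- **The ODD FLOOR** (every late time, definite threshold `starLevel M A a (1,1)`): no late Type-I top is nearly odd /
counterflow-centred at every fast point. -/
theorem oddFloor_read {ν T : ℝ} (hν : 0 < ν) (hT : 0 < T) {u : ℝ → E3 → E3} {p : ℝ → E3 → ℝ}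
    (hmax : IsMaximalSmoothSolution ν 0 u p T) (hLH : IsLerayHopfOn T ν 0 (u 0) u) (hdec : HasRapidSpatialDecay (u 0))
    {M A a : ℝ} (hM : OneLevelTop.HasTypeIConstant ν T M u) (ha : 0 < a) :
    ∀ᶠ t in 𝓝[<] T, ¬ OddCalmAt ν T u SnapshotTop.snapLevel A a (starLevel M A a (fun _ : Fin 2 => (1 : ℝ))) t :=
  (starFloor_holds ν T hν hT u p hmax hLH hdec M A a 2 (fun _ => (1 : ℝ)) hM ha (by simp)).mono
    fun _ ht hodd => ht (calmStarAt_of_oddCalmAt hodd)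

/-- **MASS ZERO IS BLIND** (hypothesis level): for BALANCED weights a UNIFORM STREAM `v` — fast everywhere at any level it
reaches — carries calm `c`-stars of every shape at every threshold `ε ≥ 0` (the weighted sum is `(∑ c i) • v = 0`).  So no row can
hold for balanced weights by any mechanism that sees only the star read-out; none is claimed. -/
theorem calmStarAt_const_of_sum_eq_zero {k : ℕ} {c : Fin k → ℝ} (hc : ∑ i, c i = 0) (ν T : ℝ) (v : E3) (Λ A a ε t : ℝ)
    (hA : 0 ≤ A) (hε : 0 ≤ ε) {e : Fin k → E3} (he : ∀ i, ‖e i‖ = 1) :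
    CalmStarAt ν T (fun _ _ => v) Λ A a c ε t := by
  intro x _
  refine ⟨e, he, 0, ⟨le_rfl, hA⟩, fun r _ => ?_⟩
  have h0 : (∑ i, c i • (fun (_ : ℝ) (_ : E3) => v) t (x + (r * Real.sqrt (ν * (T - t))) • e i)) = 0 := by
    simp only [← Finset.sum_smul, hc, zero_smul]
  rw [h0, norm_zero, mul_zero]
  exact mul_nonneg hε (Real.sqrt_nonneg ν)

/-! ## §7 Summary -/

/-- **SUMMARY.**  Row F1st (every weight vector of nonzero mass) and its eventual form F1se, the named members F1nd (LINE 37's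
needle: one ray) and F1od (odd / counterflow: two antipodal rays), the star floor, and the residual ≡ row F1.  NO SUMMIT IS
PROVED; NS regularity is NOT proved; `Row_F1` stays OPEN; residual ≡ `Row_F1`. -/
theorem starTop_summary :
    Row_F1st ∧ Row_F1se ∧ NeedleTop.Row_F1nd ∧ Row_F1od ∧ StarFloor ∧ (StarCollapse ↔ ScenarioCensus.Row_F1) :=
  ⟨rowF1st_holds, rowF1se_holds, rowF1nd_of_rowF1st rowF1st_holds, rowF1od_holds, starFloor_holds, starCollapse_iff_rowF1⟩

end Summit.NavierStokesRegularity.NavierStokesRegularity.Theorems.ScenarioCensus.StarTop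

namespace Summit.NavierStokesRegularity.NavierStokesRegularity.Theorems.ScenarioCensus

/-! ## Census KEYS (ns `…Theorems.ScenarioCensus`): the SIGNED-STAR members of row F1 (LINE 38) — TREE-decided F1st / F1se / F1od and floor STF -/

/-- **Cell F1st** (CALM SIGNED-STAR SNAPSHOTS: Type I with constant `M` · for weights `c` of nonzero mass, along some `t_k ↑ T` every `c_S`-fast point carries an `ε(M, A, a, c)`-calm `c`-star within reach `A` ⇒ smooth extension past `T`): `:= StarTop.Row_F1st`. DECIDED. -/
def Row_F1st : Prop := StarTop.Row_F1st
/-- F1st is EXCLUDED (decided in the tree): `StarTop.rowF1st_holds`. -/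
theorem row_F1st_excluded : Row_F1st := StarTop.rowF1st_holds

/-- **Cell F1se** (eventual form of the calm-star criterion): `:= StarTop.Row_F1se`. DECIDED. -/
def Row_F1se : Prop := StarTop.Row_F1se
/-- F1se is EXCLUDED (decided in the tree): `StarTop.rowF1se_holds`. -/
theorem row_F1se_excluded : Row_F1se := StarTop.rowF1se_holds

/-- **Cell F1od** (ODD / COUNTERFLOW SNAPSHOTS: nearly cancelling velocities at antipodal points `x ± rℓe` about every fast point, at snapshots ⇒ extension): `:= StarTop.Row_F1od`. DECIDED. -/
def Row_F1od : Prop := StarTop.Row_F1od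
/-- F1od is EXCLUDED (decided in the tree): `StarTop.rowF1od_holds`. -/
theorem row_F1od_excluded : Row_F1od := StarTop.rowF1od_holds

/-- **Floor STF — the STAR floor** (every late instant, maximal frame; the ODD floor is its `c = (1, 1)` instance `StarTop.oddFloor_read`): `StarTop.starFloor_holds`. -/
theorem row_F1_starFloor : StarTop.StarFloor := StarTop.starFloor_holds
/-- Order edges at key level: F1st ⇒ F1se, F1st ⇒ F1od, F1st ⇒ F1nd (`StarTop.rowF1se_of_rowF1st` / `rowF1od_of_rowF1st` / `rowF1nd_of_rowF1st`). -/
theorem rowF1se_of_rowF1st : Row_F1st → Row_F1se := StarTop.rowF1se_of_rowF1st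
/-- See `rowF1se_of_rowF1st`. -/
theorem rowF1od_of_rowF1st : Row_F1st → Row_F1od := StarTop.rowF1od_of_rowF1st
/-- See `rowF1se_of_rowF1st`. -/
theorem rowF1nd_of_rowF1st : Row_F1st → Row_F1nd := StarTop.rowF1nd_of_rowF1st

end Summit.NavierStokesRegularity.NavierStokesRegularity.Theorems.ScenarioCensus

end
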